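import Summits.HodgeConjecture.HodgeConjecture.Theorems.F0P6aDatumOfInputsDefs
import Literature.AlgebraicGeometry.AbelianSchemes.FrobeniusKernelLawBlockAssembly
import Literature.AlgebraicGeometry.AbelianSchemes.DockKernelReadingRank
import Literature.AlgebraicGeometry.GroupSchemes.FrobeniusKernelOfIdealPowerTorsion
import Literature.AlgebraicGeometry.AbelianSchemes.IdealTorsionSubgroupScheme
import Literature.NumberTheory.NumberFields.SerreTensorPresentationOfIdeal
import Literature.AlgebraicGeometry.AbelianSchemes.AbelianSchemeOverCommOfReduced
import Literature.NumberTheory.Automorphic.GaloisActionPlaces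
import HarnessLib
import HarnessLib.Audit.LibrarySuggestionsDenyListCruxes

/-!
# `F0P6aRoofCwKernelKernelReadingRank` — ★ RE-HOME of the crux workfile `Lines/F0_P6a_RoofCwKernel.lean` (tree ED. 2 sha16 20fefc6bd4d6200a, 515 l., 13 declaration commands, code-`sorry`-free), PART 1 of 2

This `Theorems/` module is the TREE BYTES of that workfile with the NAMESPACE KEPT, so every fully-qualified name is UNCHANGED; only this module docstring is re-headed,
the `Lines` imports are switched to their ★ re-homed twins — `Lines.F0_P6a_DatumOfInputs` → ★ `Theorems.F0P6aDatumOfInputsDefs` — and the audit carrier `LibrarySuggestionsDenyListCruxes` is CARRIED on this root part (bare import, LEAD «M-142d» (1) rule «P-κ»; parts 2…n inherit it transitively)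
Why a re-home: a `Theorems/` file cannot import a `Lines/` workfile (F0P6-ref1 o-6), and closing stmt-HodgeConjecture-24832 `--as proved --by <Theorems decl>` at rung 0 needs the
sorry-free `Lines` chain behind the gate (RE-HOME TABLE v1.7, LA7-plan (g7); PLAN «L3 cone RE-HOME» v1, LA3-plan (g5); LEAD F0P6-plan (g5) «M-140» (1)∕(4), 2026-09-02).
SIZE LINT (`Theorems/` files with proofs ≤ 400 l.): the workfile is cut into 2 consecutive parts `F0P6aRoofCwKernelKernelReadingRank` → `F0P6aRoofCwKernel`; this is PART 1 (tree lines :1–:357); each later part imports the previous one and re-opens the scopes open at its cut with their `variable`∕`open`∕`set_option` lines replayed verbatim; the LAST part `F0P6aRoofCwKernel` is the module the `Lines/` shim and consumers import.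
After the chain is ★ the `Lines` workfile becomes a one-import SHIM of `F0P6aRoofCwKernel` (a `Lines/` write, batched per cone on the LEAD՚s word), so no environment holds two copies (NO-CROSS-IMPORT).
It asserts nothing beyond what the workfile already proves.  HC_CM is proved only modulo the 7 printed citations (2 remaining: hLiu418 = stmt-HodgeConjecture-24832, h413 = stmt-HodgeConjecture-24833) until rung 0 closes; a re-home is count-neutral.

## Original module docstring (verbatim)
# (R3) THE `c•w` KERNEL READING OF THE REDUCED LEG `q̄` — LINES GLUE (A-p03 (g31) v1; §3 A-p03 (g32); §4 LA3-p02 (g3); LA3-plan (g2) deal 06:15:00Z, rulings (γ) 06:19:23Z, W2 07:25:01Z)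

HOME pack (cell `hodgecm-mathlib`, F0∕P6 line L3, socket `stub_FROB` ▸ `stub_ROOF0`, organ (R3)); Lines currency, nothing registered.
HC_CM is proved only modulo the 7 printed citations (2 remaining: hLiu418 24832, h413 24833) until rung 0 closes; count-neutral.

ROAD (γ) «ONE REDUCTION IN THE CELL»: `q̄ : A_x̄ → C` is the legs' ∃-witness (ROOF-LEGS leaflet, rows (r1₀)(r3₀-q)(r4₀)(r5₀)); the reduced roof hom of (ρ1) is
`ψ̄ := q̄ ≫ d̄` with `d̄` the special fibre of the MODEL return map `g_a : 𝒞 → 𝒜` of a scalar `a ∈ 𝔭_w ∖ 𝔭_{c•w}` (★ p848676 `serreTranslate_twoSided_presentation`).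
* §1 `dockClause_iff_of_comp`: on the `c•w`-dock `G₀ = A_x̄[𝔭_{c•w}]` the kernel clauses of `q̄` and of `q̄ ≫ d̄` COINCIDE (★ §5 (G1) at `x := t ≫ ι₀G`, `𝔟 := 𝔭_{c•w}`,
  `hx` = the dock row `hkerG₀`) — so (ρ1-rebased)'s dock clause for `ψ̄` IS the dock clause for `q̄`: `Ker q̄ ∩ G₀ = V(spGeoOf I 𝔡 y L)`.
* §2 `hlaw_cw_of_dockClauses`: the `c•w`-BLOCK LAW in the (rL-asm) assembler's binder shape (LA1-p03 (g3) 06:16:00Z `hlaw_v`, `v := c•w`) from: the dock clause of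
  `q̄` at `kerFOf` (§1 ∘ STATE-2 premiss `spGeoOf … = kerFOf …`), the dock FROBENIUS law (`t ≫ ι₀G ≫ F_q = 1 ↔ t` factors through `V(kerF)`), `Ker q̄` `ι`-stable
  ((r4₀)), the downstairs kernel bound `Ker q̄ ⊆ A[𝔭_w 𝔭_{c•w}]` ((hker-DOWN), LA1-p04 (g3)), and — for exponents `n ≥ 2` only — the FROBENIUS SATURATION of the
  `c•w`-block «`A[F_q] ∩ A[𝔭_{c•w}^n] ⊆ A[𝔭_{c•w}]`» (`hsat`; vacuous use at `n ≤ 1`; it is the 1-dimensionality of the `c•w`-divisible group, dock row `θU₀`).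
* §3 (v2, ADD-ONLY; A-p03 (g32) for LA3-p03 (g3)'s `hcount` (c) and the W-DOCK (E) socket) THE RANK AND AGREEMENT ROWS OF THE READING at the dock
  `𝔡 x̄` (★ p850097 `DockKernelReadingRank` instantiated at `G₀ := (𝔡 x̄).G₀`, `I := (kerFOf I 𝔡 x̄).1`, number `q = p^f` by the dock row `hrkF₀`):
  `finrank_alg_eq_of_kernelReading` («every `Z ↪ A_x̄` reading `𝔭_{c•w}`-torsion ∧ `q̄`-killed has `rk Γ(Z) = q`»), `finrank_alg_eq_of_layer_kernelReading`
  («every `K ↪ L ↪ A_x̄` reading `q̄`-killed on a `𝔭_{c•w}^n`-torsion layer `L ⊇ G₀` has `rk Γ(K) = q`», from (hker-DOWN)), `points_iff_points_of_layer_of_dockClauses`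
  (the (E) socket «`Ker q̄ ∩ L = {Q} ∩ L`» in the `hE` token shape of ★ W-DOCK `WBlockLaw.law_w_of_points`, for any second reading `Q` of the Frobenius-kernel ideal —
  from `hdock`, `hQ`, (hker-DOWN) and the saturation row `hsatQ`), `points_iff_points_of_layer_of_frobenius` (the literal instance `Q := «F_q`-killed», `hQ := hF`, `hsatQ := hsat`).
* §4 (v2∕v3, ADD-ONLY; LA3-p02 (g3), ★ p850080, drop-in 449d761e53540ddc pasted VERBATIM by the W2 pen-of-bytes A-p03 (g32) on LA3-plan (g2)'s ruling 07:25:01Z (1))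
  (hsat) FROBENIUS SATURATION OF THE `c•w` BLOCK: `le_sq_sup_span_of_not_sq_dvd`, `complexConj_smul_span_natCast`, `not_sq_smul_dvd_span_natCast` ((R-unr) at `c•w`),
  HEAD `hsat_sch₀Of` = the binder `hsat` of §2 `hlaw_cw_of_dockClauses` ∕ §3d from the dock `𝔡 : DockAt I x̄` and `hunr : ¬ 𝔭_w² ∣ (p)`.
-/

set_option autoImplicit false
set_option linter.dupNamespace false

noncomputable section

namespace Summit.HodgeConjecture.HodgeConjecture.Cruxes.HLiu418.F0P6aRoofCwKernel

open CategoryTheory CategoryTheory.Limits AlgebraicGeometry NumberField IsDedekindDomain MulAction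
open scoped Matrix Pointwise MonoidalCategory MonObj CategoryTheory.Obj
open Literature.NumberTheory.GaloisRepresentations
open Literature.NumberTheory.Automorphic Literature.NumberTheory.Automorphic.UnitaryGroup
open Literature.AlgebraicGeometry.ShimuraVarieties.UnitaryCanonicalModel
open Literature.NumberTheory.Automorphic.Liu2021.AppendixC
open Literature.AlgebraicGeometry.Motives (AlgPoints IntegralModel SchemeOver thickening thickeningLift specOver relFrobeniusOver frobeniusTwistOver frobSpec)
open Literature.NumberTheory.DiophantineGeometry (geomResidueField specResidueField)
open Literature.AlgebraicGeometry.RelativeSpec (ActionOver)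
open Literature.AlgebraicGeometry.GroupSchemes.AffineGroupScheme (Alg quotIncl)
open Literature.AlgebraicGeometry.AbelianSchemes Literature.AlgebraicGeometry.AbelianSchemes.AbelianSchemeOver
open Summit.HodgeConjecture.HodgeConjecture.Cruxes.HLiu418.F0P6aModuliDatumDefs
open Summit.HodgeConjecture.HodgeConjecture.Cruxes.HLiu418.F0P6aRGDAssembly
open Summit.HodgeConjecture.HodgeConjecture.Cruxes.HLiu418.F0P6aDatumOfInputs

/-! ### §0a Two ideal identities at the pair of primes `w ≠ c•w` -/

section Ideals

variable {F : Type} [Field F] [NumberField F] [IsCMField F] {w : HeightOneSpectrum (𝓞 F)}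

/-- `𝔭_{c•w} ≤ 𝔭_w·𝔭_{c•w} + 𝔭_{c•w}^n` for every `n` (`n = 0`: the right side is `⊤`; `n ≥ 1`: `𝔭_{c•w} = 𝔭_{c•w}·(𝔭_w + 𝔭_{c•w}^{n-1})` as `𝔭_w ≠ 𝔭_{c•w}` are
comaximal). [cite: Neukirch1999, Ch. I §3 (3.6)] -/
theorem smul_asIdeal_le_mul_sup_pow (hw' : (IsCMField.complexConj F) • w ≠ w) (n : ℕ) :
    ((IsCMField.complexConj F) • w).asIdeal ≤ w.asIdeal * ((IsCMField.complexConj F) • w).asIdeal ⊔ ((IsCMField.complexConj F) • w).asIdeal ^ n := by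
  cases n with
  | zero => simp
  | succ n =>
    have hcop : w.asIdeal ⊔ ((IsCMField.complexConj F) • w).asIdeal ^ n = ⊤ := by
      have h1 : w.asIdeal ⊔ ((IsCMField.complexConj F) • w).asIdeal = ⊤ :=
        Ideal.IsMaximal.coprime_of_ne w.isMaximal ((IsCMField.complexConj F) • w).isMaximal
          (fun h => hw' (HeightOneSpectrum.ext h.symm))
      exact Ideal.sup_pow_eq_top h1
    have h : ((IsCMField.complexConj F) • w).asIdeal * (w.asIdeal ⊔ ((IsCMField.complexConj F) • w).asIdeal ^ n) =
        w.asIdeal * ((IsCMField.complexConj F) • w).asIdeal ⊔ ((IsCMField.complexConj F) • w).asIdeal ^ (n + 1) := by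
      rw [Ideal.mul_sup, mul_comm, ← pow_succ']
    rw [hcop, Ideal.mul_top] at h
    exact h.le

/-- `(a) + 𝔭_{c•w}^n = ⊤` when `a ≡ 1 (mod 𝔭_{c•w})`. [cite: Neukirch1999, Ch. I §3 (3.6)] -/
theorem span_sup_pow_eq_top {a : 𝓞 F} (ha : a - 1 ∈ ((IsCMField.complexConj F) • w).asIdeal) (n : ℕ) :
    Ideal.span {a} ⊔ ((IsCMField.complexConj F) • w).asIdeal ^ n = ⊤ := by
  apply Ideal.sup_pow_eq_top
  rw [Ideal.eq_top_iff_one]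
  have : (1 : 𝓞 F) = a + (-(a - 1)) := by ring
  rw [this]
  exact Submodule.add_mem_sup (Ideal.mem_span_singleton_self a) ((Ideal.neg_mem_iff _).2 ha)

end Ideals

variable {F : Type} [Field F] [NumberField F] [IsCMField F] [IsGalois ℚ F] {ι₁ : F →+* ℂ}
    {Jstar : Matrix (Fin 2) (Fin 2) F}
    {K₀ : C5.OpenCompactSubgroup ↥(finAdelic ↥(maximalRealSubfield F) F (IsCMField.complexConj F) 2 Jstar)}
    {S : RecordSystemGS F Jstar ι₁ K₀} {hU7ₛ : S.HeckeTranslateDefinedOver}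
    {hJ : (Jstar.map (IsCMField.complexConj F))ᵀ = Jstar} {hJu : IsUnit Jstar}
    {Fi : Type} [Field Fi] [Algebra F Fi] {Kc : C5.SmallLevel K₀} {G : Type} [Group G]
    {𝓜 : IntegralModel (𝓞 F) F ((thickening F Fi).obj (S.M.obj Kc))}
    {w : HeightOneSpectrum (𝓞 F)} {hw : (IsCMField.complexConj F) • w ≠ w} {h𝓨 : (𝓜.localise w).IsSmoothProper 1}
    {θ : ActionOver (𝓜.localise w).total.hom ((Fi ≃ₐ[F] Fi) × G)}
    {e : Fi →ₐ[F] AlgebraicClosure (w.adicCompletion F)}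


/-! ### §0b Token seam: Defs `act₀Of` ↔ the dock's raw action (`rfl`) -/

section Seams

variable (I : RGDInputsAt F ι₁ Jstar K₀ S hU7ₛ hJ hJu Fi Kc G 𝓜 w hw h𝓨 θ e)

/-- `(act₀Of 𝓜 w I.univ I.act a x̄).hom.hom.hom` IS `((I.act.baseChange ι_s).baseChange x̄.left).i a` (★ `fibreHom_hom_hom_hom`, ★ `RingAction.baseChange_i`; `rfl`).
[cite: Kottwitz1992, §5, p. 390] -/
theorem act₀Of_hom_hom_hom (xbar : AlgPoints (𝓜.localise w).reductionAt (geomResidueField w)) (a : 𝓞 F) :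
    (act₀Of 𝓜 w I.univ I.act a xbar).hom.hom.hom =
      ((I.act.baseChange (pullback.fst (𝓜.localise w).total.hom (specResidueField w))).baseChange xbar.left).i a := rfl

end Seams

/-! ### §1 The dock clause of `q̄` from the dock clause of `q̄ ≫ d̄` ((G1) at the `c•w`-dock) -/

section DockClause

variable (I : RGDInputsAt F ι₁ Jstar K₀ S hU7ₛ hJ hJu Fi Kc G 𝓜 w hw h𝓨 θ e) [ExpChar (geomResidueField w) I.pChar]

set_option backward.isDefEq.respectTransparency false in
set_option maxHeartbeats 400000 in
/-- **§1 THE DOCK CLAUSES OF `q̄` AND OF `q̄ ≫ d̄` COINCIDE.**  `q̄ : A_x̄ → C` an `𝒪_F`-equivariant homomorphism to an abelian scheme `C∕κ̄` with action `ι_C` ((r4₀)), `d̄ : C → Z` a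
homomorphism whose kernel is `(a)`-torsion on `T`-points (`hd`; for the Serre return map: `d̄ ≫ c̄ = ι_C(a)`), `a ≡ 1 (mod 𝔭_{c•w})`.  Then for EVERY predicate `P` on
`G₀`-points: «`t ≫ ι₀G ≫ q̄ ≫ d̄ = 1 ↔ P t`» for all `t` ⟹ «`t ≫ ι₀G ≫ q̄ = 1 ↔ P t`» for all `t` (★ §5 `comp_eq_one_iff_comp_comp_eq_one_of_torsion` at `x := t ≫ ι₀G`,
`𝔟 := 𝔭_{c•w}`, `hx` = dock row `hkerG₀`).  With `P t := ∃ s, s ≫ quotIncl G₀ (spGeoOf I 𝔡 y L).1 = t` this turns (ρ1-rebased)'s clause for `ψ̄ = q̄ ≫ d̄` into the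
`c•w` KERNEL READING OF `q̄`. [cite: Liu2021, Prop. D.8 (2)–(3) pp. 135–137] [cite: Tate1997FiniteFlatGroupSchemes, (3.7)] -/
theorem dockClause_iff_of_comp (𝔡 : ∀ xbar, DockAt I xbar) (xbar : AlgPoints (𝓜.localise w).reductionAt (geomResidueField w))
    {C : AbelianSchemeOver (Spec (.of (geomResidueField w)))} (actC : RingAction (𝓞 F) C)
    (qbar : (sch₀Of 𝓜 w I.univ xbar).X ⟶ C.X) [IsMonHom qbar] {Z : SchemeOver (geomResidueField w)} [GrpObj Z] (dbar : C.X ⟶ Z) [IsMonHom dbar]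
    (hq : ∀ a : 𝓞 F, (act₀Of 𝓜 w I.univ I.act a xbar).hom.hom.hom ≫ qbar = qbar ≫ actC.i a)
    {a : 𝓞 F} (ha : a - 1 ∈ ((IsCMField.complexConj F) • w).asIdeal)
    (hd : ∀ ⦃T : SchemeOver (geomResidueField w)⦄ (z : T ⟶ C.X), z ≫ dbar = 1 → z ≫ actC.i a = 1)
    (P : ∀ ⦃T : SchemeOver (geomResidueField w)⦄, (T ⟶ (𝔡 xbar).G₀) → Prop)
    (hψ : ∀ ⦃T : SchemeOver (geomResidueField w)⦄ (t : T ⟶ (𝔡 xbar).G₀), t ≫ (𝔡 xbar).ι₀G ≫ qbar ≫ dbar = 1 ↔ P t) :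
    ∀ ⦃T : SchemeOver (geomResidueField w)⦄ (t : T ⟶ (𝔡 xbar).G₀), t ≫ (𝔡 xbar).ι₀G ≫ qbar = 1 ↔ P t := by
  intro T t
  rw [← hψ t]
  -- `x := t ≫ ι₀G` is `𝔭_{c•w}`-torsion by the dock row `hkerG₀`
  have hx : ∀ b ∈ ((IsCMField.complexConj F) • w).asIdeal,
      (t ≫ (𝔡 xbar).ι₀G) ≫ ((I.act.baseChange (pullback.fst (𝓜.localise w).total.hom (specResidueField w))).baseChange xbar.left).i b =
        (1 : T ⟶ (sch₀Of 𝓜 w I.univ xbar).X) :=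
    ((𝔡 xbar).hkerG₀ (t ≫ (𝔡 xbar).ι₀G)).2 ⟨t, rfl⟩
  have hcop : Ideal.span {a} ⊔ ((IsCMField.complexConj F) • w).asIdeal = ⊤ := by
    simpa using span_sup_pow_eq_top ha 1
  have h := comp_eq_one_iff_comp_comp_eq_one_of_torsion
    ((I.act.baseChange (pullback.fst (𝓜.localise w).total.hom (specResidueField w))).baseChange xbar.left) actC qbar dbar
    (fun b => by rw [← act₀Of_hom_hom_hom]; exact hq b) hd _ hcop (t ≫ (𝔡 xbar).ι₀G) hx
  simp only [Category.assoc] at h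
  exact h

end DockClause

/-! ### §2 The `c•w`-block law in the (rL-asm) assembler's binder shape -/

section BlockLaw

variable (I : RGDInputsAt F ι₁ Jstar K₀ S hU7ₛ hJ hJu Fi Kc G 𝓜 w hw h𝓨 θ e) [ExpChar (geomResidueField w) I.pChar]

set_option backward.isDefEq.respectTransparency false in
set_option maxHeartbeats 400000 in
/-- **§2 THE `c•w`-BLOCK LAW `hlaw_{c•w}`** (LA1-p03 (g3)'s binder 06:16:00Z at `v := c•w`): for every `n`, on `q`-torsion points `x` of `A_x̄` killed by `𝔭_{c•w}^n`,
«`x ≫ F_q = 1 ↔ ∀ a ∈ 𝔠, x ≫ ι(a) ≫ q̄ = 1`».  INPUTS: `h𝔠` (`𝔠 + 𝔭_{c•w} = 𝒪`, (π1)); `hqι` (`Ker q̄` is `ι`-stable, (r4₀)); `hkerq` (`Ker q̄ ⊆ A[𝔭_w 𝔭_{c•w}]`, (hker-DOWN));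
`hdock` (the dock clause of `q̄` at the Frobenius-kernel line — §1 composed with (ρ1-rebased) and the STATE-2 premiss `spGeoOf I 𝔡 y L = kerFOf I 𝔡 x̄`); `hF` (the dock
FROBENIUS law); `hsat` (Frobenius saturation of the block, used only in «⇒»).  PROOF «⇐»: the §4 bridge gives `x ≫ q̄ = 1`, so `x ∈ A[𝔭_w𝔭_{c•w}] ∩ A[𝔭_{c•w}^n] ⊆ A[𝔭_{c•w}] = G₀`
(§0), `x = t ≫ ι₀G`, and `hdock`, `hF` exchange `q̄` for `F_q`; «⇒»: `hsat` puts `x` in `G₀`, then `hF`, `hdock`, `hqι`.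
[cite: Liu2021, Prop. D.8 (3) p. 137] [cite: Tate1997FiniteFlatGroupSchemes, (3.7)] [cite: SGA3I, VII_A 4.1] -/
theorem hlaw_cw_of_dockClauses (𝔡 : ∀ xbar, DockAt I xbar) (xbar : AlgPoints (𝓜.localise w).reductionAt (geomResidueField w))
    {Y : SchemeOver (geomResidueField w)} [GrpObj Y] (qbar : (sch₀Of 𝓜 w I.univ xbar).X ⟶ Y) [IsMonHom qbar]
    (𝔠 : Ideal (𝓞 F)) (h𝔠 : 𝔠 ⊔ ((IsCMField.complexConj F) • w).asIdeal = ⊤)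
    (hqι : ∀ (a : 𝓞 F) ⦃T : SchemeOver (geomResidueField w)⦄ (z : T ⟶ (sch₀Of 𝓜 w I.univ xbar).X),
      z ≫ qbar = 1 → z ≫ (act₀Of 𝓜 w I.univ I.act a xbar).hom.hom.hom ≫ qbar = 1)
    (hkerq : ∀ ⦃T : SchemeOver (geomResidueField w)⦄ (z : T ⟶ (sch₀Of 𝓜 w I.univ xbar).X), z ≫ qbar = 1 →
      ∀ b ∈ w.asIdeal * ((IsCMField.complexConj F) • w).asIdeal, z ≫ (act₀Of 𝓜 w I.univ I.act b xbar).hom.hom.hom = 1)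
    (hdock : ∀ ⦃T : SchemeOver (geomResidueField w)⦄ (t : T ⟶ (𝔡 xbar).G₀),
      haveI := (𝔡 xbar).aff₀
      t ≫ (𝔡 xbar).ι₀G ≫ qbar = 1 ↔ ∃ s, s ≫ quotIncl (𝔡 xbar).G₀ (kerFOf I 𝔡 xbar).1 = t)
    (hF : ∀ ⦃T : SchemeOver (geomResidueField w)⦄ (t : T ⟶ (𝔡 xbar).G₀),
      t ≫ (𝔡 xbar).ι₀G ≫ relFrobeniusOver I.pChar I.fDeg (sch₀Of 𝓜 w I.univ xbar).X =
          (1 : T ⟶ ((sch₀Of 𝓜 w I.univ xbar).baseChange (frobSpec (geomResidueField w) I.pChar I.fDeg)).X) ↔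
        haveI := (𝔡 xbar).aff₀
        ∃ s, s ≫ quotIncl (𝔡 xbar).G₀ (kerFOf I 𝔡 xbar).1 = t)
    (hsat : ∀ (n : ℕ) ⦃T : SchemeOver (geomResidueField w)⦄ (x : T ⟶ (sch₀Of 𝓜 w I.univ xbar).X),
      (∀ b ∈ ((IsCMField.complexConj F) • w).asIdeal ^ n, x ≫ (act₀Of 𝓜 w I.univ I.act b xbar).hom.hom.hom = 1) →
      x ≫ relFrobeniusOver I.pChar I.fDeg (sch₀Of 𝓜 w I.univ xbar).X =
          (1 : T ⟶ ((sch₀Of 𝓜 w I.univ xbar).baseChange (frobSpec (geomResidueField w) I.pChar I.fDeg)).X) →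
      ∀ b ∈ ((IsCMField.complexConj F) • w).asIdeal, x ≫ (act₀Of 𝓜 w I.univ I.act b xbar).hom.hom.hom = 1) :
    ∀ (n : ℕ) ⦃T : SchemeOver (geomResidueField w)⦄ (x : T ⟶ (sch₀Of 𝓜 w I.univ xbar).X),
      x ≫ (sch₀Of 𝓜 w I.univ xbar).mulN (I.pChar ^ I.fDeg) = 1 →
      (∀ b ∈ ((IsCMField.complexConj F) • w).asIdeal ^ n, x ≫ (act₀Of 𝓜 w I.univ I.act b xbar).hom.hom.hom = 1) →
      (x ≫ relFrobeniusOver I.pChar I.fDeg (sch₀Of 𝓜 w I.univ xbar).X =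
          (1 : T ⟶ ((sch₀Of 𝓜 w I.univ xbar).baseChange (frobSpec (geomResidueField w) I.pChar I.fDeg)).X) ↔
        ∀ a ∈ 𝔠, x ≫ (act₀Of 𝓜 w I.univ I.act a xbar).hom.hom.hom ≫ qbar = 1) := by
  intro n T x _ hx
  -- a point killed by `𝔭_{c•w}` factors through the dock: `x = t ≫ ι₀G`
  have hfac : (∀ b ∈ ((IsCMField.complexConj F) • w).asIdeal, x ≫ (act₀Of 𝓜 w I.univ I.act b xbar).hom.hom.hom = 1) →
      ∃ t : T ⟶ (𝔡 xbar).G₀, t ≫ (𝔡 xbar).ι₀G = x := fun h =>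
    ((𝔡 xbar).hkerG₀ x).1 (fun b hb => by rw [← act₀Of_hom_hom_hom]; exact h b hb)
  constructor
  · -- «⇒»: saturation puts `x` on the dock, then the dock Frobenius law and the dock clause of `q̄`
    intro hFx a ha
    obtain ⟨t, rfl⟩ := hfac (hsat n x hx hFx)
    have h1 : t ≫ (𝔡 xbar).ι₀G ≫ qbar = 1 := (hdock t).2 ((hF t).1 (by simpa only [Category.assoc] using hFx))
    have h2 := hqι a (t ≫ (𝔡 xbar).ι₀G) (by simpa only [Category.assoc] using h1)
    simpa only [Category.assoc] using h2
  · -- «⇐»: the §4 bridge gives `x ≫ q̄ = 1`; then `x ∈ A[𝔭_w𝔭_{c•w}] ∩ A[𝔭_{c•w}^n] ⊆ A[𝔭_{c•w}]` is on the dock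
    intro h
    have hcop : 𝔠 ⊔ ((IsCMField.complexConj F) • w).asIdeal ^ n = ⊤ := Ideal.sup_pow_eq_top h𝔠
    have hxq : x ≫ qbar = 1 :=
      (forall_comp_i_comp_eq_one_iff_comp_eq_one
        ((I.act.baseChange (pullback.fst (𝓜.localise w).total.hom (specResidueField w))).baseChange xbar.left) qbar 𝔠 _ hcop
        (fun a T z hz => by rw [← act₀Of_hom_hom_hom]; exact hqι a z hz) x
        (fun b hb => by rw [← act₀Of_hom_hom_hom]; exact hx b hb)).1
        (fun a ha => by rw [← act₀Of_hom_hom_hom]; exact h a ha)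
    have hxcw : ∀ b ∈ ((IsCMField.complexConj F) • w).asIdeal, x ≫ (act₀Of 𝓜 w I.univ I.act b xbar).hom.hom.hom = 1 := by
      intro b hb
      have hsup : ∀ b ∈ w.asIdeal * ((IsCMField.complexConj F) • w).asIdeal ⊔ ((IsCMField.complexConj F) • w).asIdeal ^ n,
          x ≫ ((I.act.baseChange (pullback.fst (𝓜.localise w).total.hom (specResidueField w))).baseChange xbar.left).i b =
            (1 : T ⟶ (sch₀Of 𝓜 w I.univ xbar).X) :=
        (RingAction.forall_mem_sup_iff _ x).2
          ⟨fun b hb => by rw [← act₀Of_hom_hom_hom]; exact hkerq x hxq b hb, fun b hb => by rw [← act₀Of_hom_hom_hom]; exact hx b hb⟩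
      rw [act₀Of_hom_hom_hom]
      exact hsup b (smul_asIdeal_le_mul_sup_pow hw n hb)
    obtain ⟨t, rfl⟩ := hfac hxcw
    have h1 : t ≫ (𝔡 xbar).ι₀G ≫ qbar = 1 := by simpa only [Category.assoc] using hxq
    simpa only [Category.assoc] using (hF t).2 ((hdock t).1 h1)

end BlockLaw

/-! ### §3 (v2) The rank and agreement rows of the kernel reading at the dock `𝔡 x̄` (★ p850097 instantiated) -/

section KernelReadingRank

variable (I : RGDInputsAt F ι₁ Jstar K₀ S hU7ₛ hJ hJu Fi Kc G 𝓜 w hw h𝓨 θ e) [ExpChar (geomResidueField w) I.pChar]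

open Literature.AlgebraicGeometry.AbelianSchemes.DockKernelReading

set_option backward.isDefEq.respectTransparency false in
/-- **§3a `rk Γ(Z) = q` FOR EVERY READING «`𝔭_{c•w}`-TORSION ∧ `q̄`-KILLED».**  Given the dock clause of `q̄` at the Frobenius-kernel ideal (`hdock`, §1's output at the
STATE-2 premiss), every monomorphism `ζ : Z ↪ A_x̄` whose `T`-points are «`ι(r) x = 1 ∀ r ∈ 𝔭_{c•w}` ∧ `x ≫ q̄ = 1`» has `dim Γ(Z) = p^f` (★ `finrank_alg_eq_of_idealTorsion_comp_eq_one`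
at the dock rows `hkerG₀`, `hrkF₀`).  LA3-p03 (g3)'s `hcount` row (c) for `N′ = Ker q̄ ∩ 𝒢l[p]`. [cite: Tate1997FiniteFlatGroupSchemes, (3.7)] [cite: Liu2021, Prop. D.8 (3) pp. 136–138] -/
theorem finrank_alg_eq_of_kernelReading (𝔡 : ∀ xbar, DockAt I xbar) (xbar : AlgPoints (𝓜.localise w).reductionAt (geomResidueField w))
    {Y : SchemeOver (geomResidueField w)} [GrpObj Y] (qbar : (sch₀Of 𝓜 w I.univ xbar).X ⟶ Y)
    (hdock : ∀ ⦃T : SchemeOver (geomResidueField w)⦄ (t : T ⟶ (𝔡 xbar).G₀),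
      haveI := (𝔡 xbar).aff₀
      t ≫ (𝔡 xbar).ι₀G ≫ qbar = 1 ↔ ∃ s, s ≫ quotIncl (𝔡 xbar).G₀ (kerFOf I 𝔡 xbar).1 = t)
    {Z : SchemeOver (geomResidueField w)} (ζ : Z ⟶ (sch₀Of 𝓜 w I.univ xbar).X) [Mono ζ]
    (hZ : ∀ ⦃T : SchemeOver (geomResidueField w)⦄ (x : T ⟶ (sch₀Of 𝓜 w I.univ xbar).X),
      (∃ z : T ⟶ Z, z ≫ ζ = x) ↔
        (∀ r ∈ ((IsCMField.complexConj F) • w).asIdeal, x ≫ (act₀Of 𝓜 w I.univ I.act r xbar).hom.hom.hom = 1) ∧ x ≫ qbar = 1) :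
    haveI := (𝔡 xbar).aff₀
    Module.finrank (geomResidueField w) (Alg Z) = I.pChar ^ I.fDeg := by
  letI := (𝔡 xbar).grp₀
  haveI := (𝔡 xbar).aff₀
  haveI : IsClosedImmersion (𝔡 xbar).ι₀G.left := (𝔡 xbar).hι₀G.2
  haveI : Mono (𝔡 xbar).ι₀G := Over.mono_of_mono_left _
  have h := finrank_alg_eq_of_idealTorsion_comp_eq_one _ _ ((IsCMField.complexConj F) • w).asIdeal (𝔡 xbar).G₀ (𝔡 xbar).ι₀G
    (𝔡 xbar).hkerG₀ (kerFOf I 𝔡 xbar).1 qbar hdock ζ (fun T x => by simp only [act₀Of_hom_hom_hom] at hZ; exact hZ x)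
  rw [h]
  exact (𝔡 xbar).hrkF₀

set_option backward.isDefEq.respectTransparency false in
/-- **§3b `rk Γ(K) = q` FOR EVERY READING «IN THE LAYER `L` ∧ `q̄`-KILLED»** on a `𝔭_{c•w}^n`-torsion layer `jl : L ↪ A_x̄` containing the dock (`l₀ ≫ jl = ι₀G`; e.g. the `c•w`-primary
layer `𝒢l` of `A_x̄[q]`): with the downstairs kernel bound `hkerq` («`Ker q̄ ⊆ A[𝔭_w𝔭_{c•w}]`», (hker-DOWN)) every `q̄`-killed point of `L` is `𝔭_{c•w}`-torsion (§0a), so ★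
`finrank_alg_eq_of_layer_comp_eq_one` applies: «`rk Γ(Ker q̄ ∩ 𝒢l) = q`». [cite: Tate1997FiniteFlatGroupSchemes, (3.7)] [cite: Liu2021, Prop. D.8 (3) pp. 136–138] -/
theorem finrank_alg_eq_of_layer_kernelReading (𝔡 : ∀ xbar, DockAt I xbar) (xbar : AlgPoints (𝓜.localise w).reductionAt (geomResidueField w))
    {Y : SchemeOver (geomResidueField w)} [GrpObj Y] (qbar : (sch₀Of 𝓜 w I.univ xbar).X ⟶ Y)
    (hdock : ∀ ⦃T : SchemeOver (geomResidueField w)⦄ (t : T ⟶ (𝔡 xbar).G₀),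
      haveI := (𝔡 xbar).aff₀
      t ≫ (𝔡 xbar).ι₀G ≫ qbar = 1 ↔ ∃ s, s ≫ quotIncl (𝔡 xbar).G₀ (kerFOf I 𝔡 xbar).1 = t)
    (hkerq : ∀ ⦃T : SchemeOver (geomResidueField w)⦄ (z : T ⟶ (sch₀Of 𝓜 w I.univ xbar).X), z ≫ qbar = 1 →
      ∀ b ∈ w.asIdeal * ((IsCMField.complexConj F) • w).asIdeal, z ≫ (act₀Of 𝓜 w I.univ I.act b xbar).hom.hom.hom = 1)
    (n : ℕ) {L : SchemeOver (geomResidueField w)} (jl : L ⟶ (sch₀Of 𝓜 w I.univ xbar).X) [Mono jl] (l₀ : (𝔡 xbar).G₀ ⟶ L) (hl₀ : l₀ ≫ jl = (𝔡 xbar).ι₀G)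
    (hL : ∀ ⦃T : SchemeOver (geomResidueField w)⦄ (y : T ⟶ L),
      ∀ b ∈ ((IsCMField.complexConj F) • w).asIdeal ^ n, (y ≫ jl) ≫ (act₀Of 𝓜 w I.univ I.act b xbar).hom.hom.hom = 1)
    {K : SchemeOver (geomResidueField w)} (κ : K ⟶ L) [Mono κ]
    (hκ : ∀ ⦃T : SchemeOver (geomResidueField w)⦄ (y : T ⟶ L), (∃ c : T ⟶ K, c ≫ κ = y) ↔ (y ≫ jl) ≫ qbar = 1) :
    haveI := (𝔡 xbar).aff₀
    Module.finrank (geomResidueField w) (Alg K) = I.pChar ^ I.fDeg := by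
  letI := (𝔡 xbar).grp₀
  haveI := (𝔡 xbar).aff₀
  haveI : IsClosedImmersion (𝔡 xbar).ι₀G.left := (𝔡 xbar).hι₀G.2
  haveI : Mono (𝔡 xbar).ι₀G := Over.mono_of_mono_left _
  -- (hker-DOWN) on the layer: a `q̄`-killed point of `L` is `𝔭_w𝔭_{c•w}`-torsion and `𝔭_{c•w}^n`-torsion, hence `𝔭_{c•w}`-torsion (§0a)
  have hkerdown : ∀ ⦃T : SchemeOver (geomResidueField w)⦄ (y : T ⟶ L), (y ≫ jl) ≫ qbar = 1 →
      ∀ r ∈ ((IsCMField.complexConj F) • w).asIdeal,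
        (y ≫ jl) ≫ ((I.act.baseChange (pullback.fst (𝓜.localise w).total.hom (specResidueField w))).baseChange xbar.left).i r = 1 := by
    intro T y hy r hr
    have hsup : ∀ b ∈ w.asIdeal * ((IsCMField.complexConj F) • w).asIdeal ⊔ ((IsCMField.complexConj F) • w).asIdeal ^ n,
        (y ≫ jl) ≫ ((I.act.baseChange (pullback.fst (𝓜.localise w).total.hom (specResidueField w))).baseChange xbar.left).i b = 1 :=
      (RingAction.forall_mem_sup_iff _ (y ≫ jl)).2
        ⟨fun b hb => by rw [← act₀Of_hom_hom_hom]; exact hkerq (y ≫ jl) hy b hb, fun b hb => by rw [← act₀Of_hom_hom_hom]; exact hL y b hb⟩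
    exact hsup r (smul_asIdeal_le_mul_sup_pow hw n hr)
  have h := finrank_alg_eq_of_layer_comp_eq_one _ _ ((IsCMField.complexConj F) • w).asIdeal (𝔡 xbar).G₀ (𝔡 xbar).ι₀G
    (𝔡 xbar).hkerG₀ (kerFOf I 𝔡 xbar).1 qbar hdock jl l₀ hl₀ hkerdown κ hκ
  rw [h]
  exact (𝔡 xbar).hrkF₀

set_option backward.isDefEq.respectTransparency false in
set_option maxHeartbeats 400000 in -- rung-E fix-forward (f0), LEAD «M-136a»: K4-shim environment pushes whnf past the default 200 000; statement∕proof bytes unchanged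
/-- **§3c THE (E) SOCKET ON A LAYER: `Ker q̄ ∩ L = {Q} ∩ L`** for ANY second reading `Q` of the Frobenius-kernel ideal on the dock (`hQ`; the application is `Q x := x ≫ F_q = 1`
with `hQ := hF` the dock Frobenius law and `hsatQ := hsat` the Frobenius saturation of the `c•w`-block — kept abstract here so that no Frobenius-twist term is elaborated in
this leaflet; §3d is the literal instance).  On a `𝔭_{c•w}^n`-torsion layer `jl : L → A_x̄`, for subobjects `κ : K → L` reading «`q̄`-killed» and `φ : Φ → L` reading `Q`, the
`T`-points coincide — from the two dock clauses `hdock`, `hQ`, the downstairs kernel bound `hkerq` ((hker-DOWN), with §0a) and `hsatQ`; ★ `points_iff_points_of_layer`.  This is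
the binder `hE` of ★ W-DOCK `WBlockLaw.law_w_of_points` at `L := 𝒢l`, `jl := j𝒢 ≫ j`. [cite: Liu2021, Prop. D.8 (3) pp. 136–138] [cite: Tate1997FiniteFlatGroupSchemes, (3.7)] -/
theorem points_iff_points_of_layer_of_dockClauses (𝔡 : ∀ xbar, DockAt I xbar) (xbar : AlgPoints (𝓜.localise w).reductionAt (geomResidueField w))
    {Y : SchemeOver (geomResidueField w)} [GrpObj Y] (qbar : (sch₀Of 𝓜 w I.univ xbar).X ⟶ Y)
    (hdock : ∀ ⦃T : SchemeOver (geomResidueField w)⦄ (t : T ⟶ (𝔡 xbar).G₀),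
      haveI := (𝔡 xbar).aff₀
      t ≫ (𝔡 xbar).ι₀G ≫ qbar = 1 ↔ ∃ s, s ≫ quotIncl (𝔡 xbar).G₀ (kerFOf I 𝔡 xbar).1 = t)
    (Q : ∀ ⦃T : SchemeOver (geomResidueField w)⦄, (T ⟶ (sch₀Of 𝓜 w I.univ xbar).X) → Prop)
    (hQ : ∀ ⦃T : SchemeOver (geomResidueField w)⦄ (t : T ⟶ (𝔡 xbar).G₀),
      haveI := (𝔡 xbar).aff₀
      Q (t ≫ (𝔡 xbar).ι₀G) ↔ ∃ s, s ≫ quotIncl (𝔡 xbar).G₀ (kerFOf I 𝔡 xbar).1 = t)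
    (hkerq : ∀ ⦃T : SchemeOver (geomResidueField w)⦄ (z : T ⟶ (sch₀Of 𝓜 w I.univ xbar).X), z ≫ qbar = 1 →
      ∀ b ∈ w.asIdeal * ((IsCMField.complexConj F) • w).asIdeal, z ≫ (act₀Of 𝓜 w I.univ I.act b xbar).hom.hom.hom = 1)
    (hsatQ : ∀ (n : ℕ) ⦃T : SchemeOver (geomResidueField w)⦄ (x : T ⟶ (sch₀Of 𝓜 w I.univ xbar).X),
      (∀ b ∈ ((IsCMField.complexConj F) • w).asIdeal ^ n, x ≫ (act₀Of 𝓜 w I.univ I.act b xbar).hom.hom.hom = 1) → Q x →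
      ∀ b ∈ ((IsCMField.complexConj F) • w).asIdeal, x ≫ (act₀Of 𝓜 w I.univ I.act b xbar).hom.hom.hom = 1)
    (n : ℕ) {L : SchemeOver (geomResidueField w)} (jl : L ⟶ (sch₀Of 𝓜 w I.univ xbar).X)
    (hL : ∀ ⦃T : SchemeOver (geomResidueField w)⦄ (y : T ⟶ L),
      ∀ b ∈ ((IsCMField.complexConj F) • w).asIdeal ^ n, (y ≫ jl) ≫ (act₀Of 𝓜 w I.univ I.act b xbar).hom.hom.hom = 1)
    {K : SchemeOver (geomResidueField w)} (κ : K ⟶ L)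
    (hκ : ∀ ⦃T : SchemeOver (geomResidueField w)⦄ (y : T ⟶ L), (∃ c : T ⟶ K, c ≫ κ = y) ↔ (y ≫ jl) ≫ qbar = 1)
    {Φ : SchemeOver (geomResidueField w)} (φ : Φ ⟶ L)
    (hφ : ∀ ⦃T : SchemeOver (geomResidueField w)⦄ (y : T ⟶ L), (∃ c : T ⟶ Φ, c ≫ φ = y) ↔ Q (y ≫ jl)) :
    ∀ ⦃T : SchemeOver (geomResidueField w)⦄ (y : T ⟶ L), (∃ c : T ⟶ Φ, c ≫ φ = y) ↔ ∃ c : T ⟶ K, c ≫ κ = y := by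
  letI := (𝔡 xbar).grp₀
  haveI := (𝔡 xbar).aff₀
  haveI : IsClosedImmersion (𝔡 xbar).ι₀G.left := (𝔡 xbar).hι₀G.2
  haveI : Mono (𝔡 xbar).ι₀G := Over.mono_of_mono_left _
  intro T y
  -- both readings put the point on the dock: (hker-DOWN) + §0a, resp. the saturation row
  have hkerdown : ∀ ⦃T : SchemeOver (geomResidueField w)⦄ (y : T ⟶ L), (y ≫ jl) ≫ qbar = 1 →
      ∀ r ∈ ((IsCMField.complexConj F) • w).asIdeal,
        (y ≫ jl) ≫ ((I.act.baseChange (pullback.fst (𝓜.localise w).total.hom (specResidueField w))).baseChange xbar.left).i r = 1 := by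
    intro T y hy r hr
    have hsup : ∀ b ∈ w.asIdeal * ((IsCMField.complexConj F) • w).asIdeal ⊔ ((IsCMField.complexConj F) • w).asIdeal ^ n,
        (y ≫ jl) ≫ ((I.act.baseChange (pullback.fst (𝓜.localise w).total.hom (specResidueField w))).baseChange xbar.left).i b = 1 :=
      (RingAction.forall_mem_sup_iff _ (y ≫ jl)).2
        ⟨fun b hb => by rw [← act₀Of_hom_hom_hom]; exact hkerq (y ≫ jl) hy b hb, fun b hb => by rw [← act₀Of_hom_hom_hom]; exact hL y b hb⟩
    exact hsup r (smul_asIdeal_le_mul_sup_pow hw n hr)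
  have hQdown : ∀ ⦃T : SchemeOver (geomResidueField w)⦄ (y : T ⟶ L), Q (y ≫ jl) →
      ∀ r ∈ ((IsCMField.complexConj F) • w).asIdeal,
        (y ≫ jl) ≫ ((I.act.baseChange (pullback.fst (𝓜.localise w).total.hom (specResidueField w))).baseChange xbar.left).i r = 1 := by
    intro T y hy r hr
    rw [← act₀Of_hom_hom_hom]
    exact hsatQ n (y ≫ jl) (hL y) hy r hr
  exact points_iff_points_of_layer _ _ ((IsCMField.complexConj F) • w).asIdeal (𝔡 xbar).G₀ (𝔡 xbar).ι₀G (𝔡 xbar).hkerG₀ (kerFOf I 𝔡 xbar).1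
    qbar hdock Q hQ jl hkerdown hQdown κ hκ φ hφ y


/-! (★ re-home, size lint: PART 1 of 2 ends here at tree line :357; the workfile continues, in the same namespace, in `Theorems/F0P6aRoofCwKernel.lean`.) -/

end KernelReadingRank
end Summit.HodgeConjecture.HodgeConjecture.Cruxes.HLiu418.F0P6aRoofCwKernel
end
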